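import Mathlib.LinearAlgebra.FiniteDimensional.Lemmas
import Mathlib.LinearAlgebra.Dimension.Constructions
import Mathlib.LinearAlgebra.Dimension.FreeAndStrongRankCondition
import Literature.Topology.FourManifolds.LeeXAction
import Literature.Topology.FourManifolds.LeeRasmussen
import HarnessLib

/-!
# Rasmussen's `s_max = s_min + 2` from Lee's rank-two theorem

Sibling proof file of `LeeRasmussen.lean` for the named fact
`GaussDiagram.leeSMax_eq_leeSMin_add_two` (Rasmussen (2010), Prop. 3.3, `Prop:MinMax`; the
siblings `LeeRasmussenProofs`, `LeeRasmussenLabProofs`, `LeeRasmussenMirrorProofs`,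
`LeeRasmussenParityProofs` treat invariance, Lee's generators, the mirror and the parity).
This file proves the reduction
`leeSMax_eq_leeSMin_add_two_of_finrank : finrank_leeHomologyZero_eq_two → leeSMax_eq_leeSMin_add_two`
of Rasmussen's Proposition 3.3 (`s_max(K) = s_min(K) + 2`, the named fact
`GaussDiagram.leeSMax_eq_leeSMin_add_two` of `LeeRasmussen`) to Lee's theorem that the
degree-zero Lee homology of a knot diagram is two-dimensional (the named fact
`GaussDiagram.finrank_leeHomologyZero_eq_two`). In fact the dimension statement alone implies
the conclusion for *every* Gauss diagram (`leeSMax_eq_leeSMin_add_two_of_finrank_eq_two`),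
realisable or not.

## The argument

Rasmussen's printed proof of Prop. 3.3 goes through Lee's canonical generators, the splitting
`CKh' = CKh'_o ⊕ CKh'_e` by `q mod 4` (Lemma 3.5), `s_max > s_min` (Cor. 3.7) and a short
exact sequence for the connected sum with an unknot drawn as a two-component link diagram
(Lemma 3.8). Link diagrams are not available for `GaussDiagram` (knots only), so we replace
Lemma 3.8 by the action of `X` at a base point (Khovanov (2006), *Bar-Natan's theory and the
Rasmussen invariant*: the Lee complex of a knot diagram is a complex of `ℚ[X]/(X² - 1)`-modules),
which is a filtered chain map of degree `-2` exchanging the two `q mod 4` summands: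

* (`LeeXAction`) on cochains, the projectors `P_ρ` (`ρ : ZMod 4`) onto `q ≡ ρ (mod 4)` commute
  with Lee's differential, and the involution `X` satisfies `X P_ρ = P_{ρ+2} X`; both descend
  to `Kh'⁰ = ker d₀ / (im d₋₁ ⊓ ker d₀)` (`qProjBar`, `leeXBar`);
* hence `Kh'⁰ = ⊕_ρ E_ρ` with `X : E_ρ ≅ E_{ρ+2}`; if `dim Kh'⁰ = 2` then for some `ρ₀` the
  summands `E_{ρ₀}`, `E_{ρ₀+2}` are lines and the other two vanish
  (`exists_finrank_range_qProjBar`);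
* the filtration degree `s(α)` (`classDegree`) of a nonzero class in `E_ρ` is an integer
  `≡ ρ (mod 4)` (project an optimal representative), `s(α₁ + α₂) = min (s α₁) (s α₂)` for
  nonzero `αᵢ` in the two lines, and `s(X α) ≥ s(α) - 2`;
* so the `s`-values of nonzero classes are `{m₁, m₂, min m₁ m₂}` with `m₁ ≡ ρ₀`,
  `m₂ ≡ ρ₀ + 2 (mod 4)` and `|m₁ - m₂| ≤ 2`, whence `s_max = max = min + 2 = s_min + 2`.

## Sources

* J. Rasmussen, *Khovanov homology and the slice genus*, Invent. Math. 182 (2010), §3,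
  Def. 3.1, Prop. 3.3, Lemma 3.5, Cor. 3.6–3.7.
* E. S. Lee, *An endomorphism of the Khovanov invariant*, Adv. Math. 197 (2005), Thm. 4.2.
* M. Khovanov, *Link homology and Frobenius extensions*, Fund. Math. 190 (2006) 179–190,
  paragraph *Bar-Natan's theory and the Rasmussen invariant*, Prop. 8 (`H'(K) ≅ ℚ[X]{-s-1}`).
* Mathlib: `Submodule.mapQ`, `Module.finrank_pi_fintype`, `LinearMap.finrank_range_add_finrank_ker`,
  `finrank_eq_one_iff'`, complete-lattice `iSup₂`/`iInf₂` API on `WithBot (WithTop ℤ)`.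

## Design choices

* No named fact is used; the only input beyond the tree is the hypothesis
  `Module.finrank ℚ G.LeeHomologyZero = 2`, so the main theorem is stated for all Gauss
  diagrams and then specialised to the shape of the two named facts.
* Degrees of chains and classes live in `WithBot (WithTop ℤ)` as in `LeeRasmussen`; the lemmas
  `exists_qMin_eq_coe`, `exists_classDegree_eq_coe` extract honest integers for nonzero
  chains and classes.
-/

open Function Set

noncomputable section

namespace Literature.Topology.FourManifolds

/-! ## Linear algebra: complete orthogonal idempotents -/

section LinearAlgebra

variable {K V : Type*} [Field K] [AddCommGroup V] [Module K V]

/-- An involution of a module mapping a submodule `p` into `q` and `q` into `p` restricts to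
a linear equivalence `p ≃ q`. [folklore] -/
def linearEquivOfInvolutive (X : V →ₗ[K] V) (hX : ∀ v, X (X v) = v) (p q : Submodule K V)
    (hpq : ∀ v ∈ p, X v ∈ q) (hqp : ∀ v ∈ q, X v ∈ p) : p ≃ₗ[K] q :=
  LinearEquiv.ofLinear (X.restrict hpq) (X.restrict hqp)
    (by ext v; simp [hX])
    (by ext v; simp [hX])

/-- **Complete orthogonal idempotents split the dimension**: if `e i` are pairwise orthogonal
idempotent endomorphisms of a finite-dimensional vector space summing to the identity, the
dimension is the sum of the dimensions of their images (`V ≅ Π i, range (e i)`). [folklore] -/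
theorem finrank_eq_sum_finrank_range [FiniteDimensional K V] {ι : Type*} [Fintype ι]
    [DecidableEq ι] (e : ι → V →ₗ[K] V) (hidem : ∀ i, e i ∘ₗ e i = e i)
    (horth : ∀ i j, i ≠ j → e i ∘ₗ e j = 0) (hsum : ∑ i, e i = LinearMap.id) :
    Module.finrank K V = ∑ i, Module.finrank K (LinearMap.range (e i)) := by
  let Φ : V →ₗ[K] (Π i, LinearMap.range (e i)) := LinearMap.pi (fun i ↦ (e i).rangeRestrict)
  let Ψ : (Π i, LinearMap.range (e i)) →ₗ[K] V :=
    ∑ i, (LinearMap.range (e i)).subtype ∘ₗ LinearMap.proj i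
  have hΨΦ : Ψ ∘ₗ Φ = LinearMap.id := by
    refine LinearMap.ext (fun v ↦ ?_)
    have := LinearMap.congr_fun hsum v
    simpa [Φ, Ψ] using this
  have hΦΨ : Φ ∘ₗ Ψ = LinearMap.id := by
    refine LinearMap.ext (fun y ↦ funext (fun i ↦ Subtype.ext ?_))
    change e i (Ψ y) = (y i : V)
    have hΨ : Ψ y = ∑ j, (y j : V) := by simp [Ψ]
    rw [hΨ, map_sum, Finset.sum_eq_single i]
    · obtain ⟨w, hw⟩ := (y i).2
      rw [← hw, ← LinearMap.comp_apply, hidem]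
    · intro j _ hji
      obtain ⟨w, hw⟩ := (y j).2
      rw [← hw, ← LinearMap.comp_apply, horth i j (Ne.symm hji), LinearMap.zero_apply]
    · exact fun h ↦ (h (Finset.mem_univ i)).elim
  have E : V ≃ₗ[K] (Π i, LinearMap.range (e i)) := LinearEquiv.ofLinear Φ Ψ hΦΨ hΨΦ
  rw [E.finrank_eq, Module.finrank_pi_fintype]

end LinearAlgebra

namespace GaussDiagram

variable (G : GaussDiagram)

/-! ## Degree-zero Lee homology: induced operators -/

/-- The **degree-zero Lee boundaries** inside the degree-zero cycles: the range of `d₋₁`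
pulled back to `leeCycles G`, literally the submodule by which `LeeHomologyZero G` is the
quotient of `leeCycles G`. Rasmussen (2010), §2.1. [cite: Rasmussen2010, §2.1] -/
abbrev leeBoundaries : Submodule ℚ G.leeCycles :=
  (LinearMap.range (G.khovanovD ℚ 0 1 (0 - 1) 0)).comap G.leeCycles.subtype

/-- The carrier `ker d₀ ⧸ (im d₋₁ ⊓ ker d₀)` of **degree-zero Lee homology with its
quotient-module structure**. This is *definitionally* `G.LeeHomologyZero` (whose module
structure is the same one, seen through `ModuleCat.of`); all homology-level statements below
are phrased with `LeeH0` so that the quotient-module lemmas of Mathlib apply verbatim, and are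
transported to `LeeHomologyZero`, `classDegree`, `leeSMin`, `leeSMax` by definitional unfolding.
Rasmussen (2010), §2.1. [cite: Rasmussen2010, §2.1] -/
abbrev LeeH0 : Type := G.leeCycles ⧸ G.leeBoundaries

/-- `LeeH0` is `LeeHomologyZero` (definitionally). [folklore] -/
theorem leeH0_eq_leeHomologyZero : G.LeeH0 = G.LeeHomologyZero := rfl

variable {G}

/-- A cochain operator commuting with `d₀` preserves the degree-zero cycles. [folklore] -/
theorem map_mem_leeCycles {T : (G.degStates 0 → ℚ) →ₗ[ℚ] (G.degStates 0 → ℚ)}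
    {T' : (G.degStates (0 + 1) → ℚ) →ₗ[ℚ] (G.degStates (0 + 1) → ℚ)}
    (h : G.khovanovD ℚ 0 1 0 (0 + 1) ∘ₗ T = T' ∘ₗ G.khovanovD ℚ 0 1 0 (0 + 1))
    (x : G.degStates 0 → ℚ) (hx : x ∈ G.leeCycles) : T x ∈ G.leeCycles := by
  rw [LinearMap.mem_ker] at hx ⊢
  have := LinearMap.congr_fun h x
  simp only [LinearMap.coe_comp, Function.comp_apply] at this
  rw [this, hx, map_zero]

/-- A cochain operator commuting with `d₋₁` preserves the degree-zero boundaries. [folklore] -/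
theorem map_mem_range_khovanovD {T : (G.degStates 0 → ℚ) →ₗ[ℚ] (G.degStates 0 → ℚ)}
    {T' : (G.degStates (0 - 1) → ℚ) →ₗ[ℚ] (G.degStates (0 - 1) → ℚ)}
    (h : G.khovanovD ℚ 0 1 (0 - 1) 0 ∘ₗ T' = T ∘ₗ G.khovanovD ℚ 0 1 (0 - 1) 0)
    (x : G.degStates 0 → ℚ) (hx : x ∈ LinearMap.range (G.khovanovD ℚ 0 1 (0 - 1) 0)) :
    T x ∈ LinearMap.range (G.khovanovD ℚ 0 1 (0 - 1) 0) := by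
  obtain ⟨y, rfl⟩ := hx
  have := LinearMap.congr_fun h y
  simp only [LinearMap.coe_comp, Function.comp_apply] at this
  exact ⟨T' y, this⟩

variable (G) in
/-- The operator on degree-zero Lee homology `Kh'⁰ = ker d₀ ⧸ (im d₋₁ ⊓ ker d₀)` induced by a
cochain operator preserving cycles and boundaries. [folklore] -/
def leeInduced (T : (G.degStates 0 → ℚ) →ₗ[ℚ] (G.degStates 0 → ℚ))
    (hK : ∀ x ∈ G.leeCycles, T x ∈ G.leeCycles)
    (hB : ∀ x ∈ LinearMap.range (G.khovanovD ℚ 0 1 (0 - 1) 0),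
      T x ∈ LinearMap.range (G.khovanovD ℚ 0 1 (0 - 1) 0)) :
    G.LeeH0 →ₗ[ℚ] G.LeeH0 :=
  Submodule.mapQ G.leeBoundaries G.leeBoundaries (T.restrict hK) (fun _ hz ↦ hB _ hz)

/-- The induced operator on the class of a cycle is the class of its image. [folklore] -/
theorem leeInduced_mk (T : (G.degStates 0 → ℚ) →ₗ[ℚ] (G.degStates 0 → ℚ))
    (hK : ∀ x ∈ G.leeCycles, T x ∈ G.leeCycles)
    (hB : ∀ x ∈ LinearMap.range (G.khovanovD ℚ 0 1 (0 - 1) 0),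
      T x ∈ LinearMap.range (G.khovanovD ℚ 0 1 (0 - 1) 0)) (z : G.leeCycles) :
    G.leeInduced T hK hB (Submodule.Quotient.mk z) =
      (Submodule.Quotient.mk ⟨T z, hK _ z.2⟩ : G.LeeH0) :=
  rfl

variable (G)

/-- **The `q mod 4` projector on degree-zero Lee homology** (`Kh'⁰ = ⊕_ρ Kh'⁰_ρ`, the images
of these projectors). Rasmussen (2010), Lemma 3.5. [cite: Rasmussen2010, Lemma 3.5] -/
def qProjBar (ρ : ZMod 4) : G.LeeH0 →ₗ[ℚ] G.LeeH0 :=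
  G.leeInduced (G.qProj ℚ ρ 0) (map_mem_leeCycles (G.khovanovD_comp_qProj ℚ ρ 0 (0 + 1)))
    (map_mem_range_khovanovD (G.khovanovD_comp_qProj ℚ ρ (0 - 1) 0))

/-- **The `X`-operator on degree-zero Lee homology** (multiplication by `X` at the arc `α`;
Lee homology of a knot diagram is an `ℚ[X]/(X² - 1)`-module). Khovanov (2006), *Bar-Natan's
theory and the Rasmussen invariant*, Prop. 8 and the discussion before it. [cite: Khovanov2006, Prop. 8] -/
def leeXBar (α : G.Arc) : G.LeeH0 →ₗ[ℚ] G.LeeH0 :=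
  G.leeInduced (G.leeX ℚ α 0) (map_mem_leeCycles (G.khovanovD_comp_leeX ℚ α 0 (0 + 1)))
    (map_mem_range_khovanovD (G.khovanovD_comp_leeX ℚ α (0 - 1) 0))

variable {G}

/-- `qProjBar` on the class of a cycle. [folklore] -/
theorem qProjBar_mk (ρ : ZMod 4) (z : G.leeCycles) :
    G.qProjBar ρ (Submodule.Quotient.mk z) =
      (Submodule.Quotient.mk ⟨G.qProj ℚ ρ 0 z,
        map_mem_leeCycles (G.khovanovD_comp_qProj ℚ ρ 0 (0 + 1)) _ z.2⟩ : G.LeeH0) :=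
  rfl

/-- `leeXBar` on the class of a cycle. [folklore] -/
theorem leeXBar_mk (α : G.Arc) (z : G.leeCycles) :
    G.leeXBar α (Submodule.Quotient.mk z) =
      (Submodule.Quotient.mk ⟨G.leeX ℚ α 0 z,
        map_mem_leeCycles (G.khovanovD_comp_leeX ℚ α 0 (0 + 1)) _ z.2⟩ : G.LeeH0) :=
  rfl

/-- The homology projectors are idempotent. [folklore] -/
theorem qProjBar_qProjBar (ρ : ZMod 4) (a : G.LeeH0) :
    G.qProjBar ρ (G.qProjBar ρ a) = G.qProjBar ρ a := by
  obtain ⟨z, rfl⟩ := Submodule.Quotient.mk_surjective _ a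
  rw [qProjBar_mk, qProjBar_mk]
  congr 2
  exact LinearMap.congr_fun (G.qProj_comp_qProj_self ℚ ρ 0) z.1

/-- The homology projectors are idempotent, as a composition. [folklore] -/
theorem qProjBar_comp_self (ρ : ZMod 4) : G.qProjBar ρ ∘ₗ G.qProjBar ρ = G.qProjBar ρ :=
  LinearMap.ext (qProjBar_qProjBar ρ)

/-- The homology projectors are mutually orthogonal. [folklore] -/
theorem qProjBar_qProjBar_of_ne {ρ ρ' : ZMod 4} (h : ρ ≠ ρ') (a : G.LeeH0) :
    G.qProjBar ρ (G.qProjBar ρ' a) = 0 := by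
  obtain ⟨z, rfl⟩ := Submodule.Quotient.mk_surjective _ a
  rw [qProjBar_mk, qProjBar_mk, ← (Submodule.mkQ G.leeBoundaries).map_zero, Submodule.mkQ_apply]
  congr 1
  refine Subtype.ext ?_
  exact LinearMap.congr_fun (G.qProj_comp_qProj_of_ne ℚ h 0) z.1

/-- The homology projectors are mutually orthogonal, as a composition. [folklore] -/
theorem qProjBar_comp_of_ne {ρ ρ' : ZMod 4} (h : ρ ≠ ρ') : G.qProjBar ρ ∘ₗ G.qProjBar ρ' = 0 :=
  LinearMap.ext (qProjBar_qProjBar_of_ne h)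

/-- The homology projectors sum to the identity. [folklore] -/
theorem sum_qProjBar (a : G.LeeH0) : ∑ ρ, G.qProjBar ρ a = a := by
  obtain ⟨z, rfl⟩ := Submodule.Quotient.mk_surjective _ a
  simp only [qProjBar_mk]
  change ∑ ρ, Submodule.mkQ G.leeBoundaries _ = Submodule.mkQ G.leeBoundaries z
  rw [← map_sum]
  congr 1
  refine Subtype.ext ?_
  rw [Submodule.coe_sum]
  have := LinearMap.congr_fun (G.sum_qProj ℚ 0) z.1
  simpa using this

/-- The homology projectors sum to the identity, as linear maps. [folklore] -/
theorem sum_qProjBar_eq_id : ∑ ρ, G.qProjBar ρ = LinearMap.id := by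
  refine LinearMap.ext (fun a ↦ ?_)
  rw [LinearMap.coe_sum, Finset.sum_apply]
  exact sum_qProjBar a

/-- The homology `X`-operator is an involution. [folklore] -/
theorem leeXBar_leeXBar (α : G.Arc) (a : G.LeeH0) : G.leeXBar α (G.leeXBar α a) = a := by
  obtain ⟨z, rfl⟩ := Submodule.Quotient.mk_surjective _ a
  rw [leeXBar_mk, leeXBar_mk]
  congr 1
  exact Subtype.ext (G.leeX_leeX ℚ α 0 z.1)

/-- **The homology `X`-operator rotates the `q mod 4` splitting by two.** Rasmussen (2010),
Lemma 3.5. [cite: Rasmussen2010, Lemma 3.5] -/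
theorem leeXBar_qProjBar (α : G.Arc) (ρ : ZMod 4) (a : G.LeeH0) :
    G.leeXBar α (G.qProjBar ρ a) = G.qProjBar (ρ + 2) (G.leeXBar α a) := by
  obtain ⟨z, rfl⟩ := Submodule.Quotient.mk_surjective _ a
  rw [qProjBar_mk, leeXBar_mk, leeXBar_mk, qProjBar_mk]
  congr 1
  refine Subtype.ext ?_
  exact LinearMap.congr_fun (G.leeX_comp_qProj ℚ α ρ 0) z.1

/-- In `ZMod 4`, adding `2` twice is the identity. [folklore] -/
theorem zmod_four_add_two_add_two (ρ : ZMod 4) : ρ + 2 + 2 = ρ := by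
  revert ρ; decide

/-- In `ZMod 4`, every element is one of `ρ₀, ρ₀ + 1, ρ₀ + 2, ρ₀ + 3`. [folklore] -/
theorem zmod_four_eq_add_cases (ρ₀ ρ : ZMod 4) : ρ = ρ₀ ∨ ρ = ρ₀ + 1 ∨ ρ = ρ₀ + 2 ∨ ρ = ρ₀ + 3 := by
  revert ρ₀ ρ; decide

/-- `X` maps the `ρ`-summand of degree-zero Lee homology into the `(ρ + 2)`-summand. [folklore] -/
theorem leeXBar_mem_range (α : G.Arc) (ρ : ZMod 4) {a : G.LeeH0}
    (ha : a ∈ LinearMap.range (G.qProjBar ρ)) :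
    G.leeXBar α a ∈ LinearMap.range (G.qProjBar (ρ + 2)) := by
  obtain ⟨b, rfl⟩ := ha
  exact ⟨G.leeXBar α b, (leeXBar_qProjBar α ρ b).symm⟩

/-- **`X : Kh'⁰_ρ ≅ Kh'⁰_{ρ+2}`**: the summands two apart have the same dimension.
Rasmussen (2010), Lemma 3.5, Cor. 3.7. [cite: Rasmussen2010, Lemma 3.5] -/
theorem finrank_range_qProjBar_add_two (α : G.Arc) (ρ : ZMod 4) :
    Module.finrank ℚ (LinearMap.range (G.qProjBar ρ)) =
      Module.finrank ℚ (LinearMap.range (G.qProjBar (ρ + 2))) := by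
  refine (linearEquivOfInvolutive (G.leeXBar α) (leeXBar_leeXBar α) _ _
    (fun a ha ↦ leeXBar_mem_range α ρ ha) (fun a ha ↦ ?_)).finrank_eq
  have := leeXBar_mem_range α (ρ + 2) ha
  rwa [zmod_four_add_two_add_two] at this

/-- **The dimension of `Kh'⁰` is the sum of the dimensions of its `q mod 4` summands.**
Rasmussen (2010), Lemma 3.5. [cite: Rasmussen2010, Lemma 3.5] -/
theorem finrank_leeH0_eq_sum :
    Module.finrank ℚ G.LeeH0 = ∑ ρ, Module.finrank ℚ (LinearMap.range (G.qProjBar ρ)) :=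
  finrank_eq_sum_finrank_range G.qProjBar qProjBar_comp_self (fun _ _ h ↦ qProjBar_comp_of_ne h)
    sum_qProjBar_eq_id

/-- **The shape of `Kh'⁰` when it is two-dimensional**: two of the `q mod 4` summands, two
apart, are lines and the other two vanish (`Kh'⁰ = Kh'⁰_{ρ₀} ⊕ Kh'⁰_{ρ₀+2}`, each `≅ ℚ`).
Rasmussen (2010), Lemma 3.5, Cor. 3.7. [cite: Rasmussen2010, Cor. 3.7] -/
theorem exists_finrank_range_qProjBar (α : G.Arc) (h2 : Module.finrank ℚ G.LeeH0 = 2) :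
    ∃ ρ₀ : ZMod 4, Module.finrank ℚ (LinearMap.range (G.qProjBar ρ₀)) = 1 ∧
      Module.finrank ℚ (LinearMap.range (G.qProjBar (ρ₀ + 2))) = 1 ∧
      G.qProjBar (ρ₀ + 1) = 0 ∧ G.qProjBar (ρ₀ + 3) = 0 := by
  set n : ZMod 4 → ℕ := fun ρ ↦ Module.finrank ℚ (LinearMap.range (G.qProjBar ρ)) with hn
  have hsum : n 0 + n 1 + n 2 + n 3 = 2 := by
    rw [finrank_leeH0_eq_sum] at h2
    exact (Fin.sum_univ_four n).symm.trans h2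
  have h02 : n 0 = n 2 := finrank_range_qProjBar_add_two α 0
  have h13 : n 1 = n 3 := finrank_range_qProjBar_add_two α 1
  have hzero : ∀ ρ, n ρ = 0 → G.qProjBar ρ = 0 := fun ρ hρ ↦ by
    rw [← LinearMap.range_eq_bot, ← Submodule.finrank_eq_zero]
    exact hρ
  rcases (show (n 0 = 1 ∧ n 1 = 0) ∨ (n 0 = 0 ∧ n 1 = 1) by omega) with ⟨h0, h1⟩ | ⟨h0, h1⟩
  · refine ⟨0, h0, ?_, hzero 1 (by simpa using h1), hzero 3 (by rw [← h13]; exact h1)⟩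
    change n 2 = 1
    rw [← h02, h0]
  · refine ⟨1, h1, ?_, hzero 2 (by rw [← h02]; exact h0), ?_⟩
    · change n 3 = 1
      rw [← h13, h1]
    · change G.qProjBar 0 = 0
      exact hzero 0 h0

/-! ## Filtration degrees of chains -/

/-- A chain vanishing outside the support of another has at least its filtration degree. [folklore] -/
theorem qMin_le_qMin_of_support {x y : G.degStates 0 → ℚ} (h : ∀ s, y s ≠ 0 → x s ≠ 0) :
    qMin x ≤ qMin y :=
  le_iInf₂ fun s hs ↦ iInf₂_le s (h s hs)

/-- The filtration degree of a chain is at most the quantum degree of any state in its support. [folklore] -/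
theorem qMin_le_coe {x : G.degStates 0 → ℚ} {s : G.degStates 0} (hs : x s ≠ 0) :
    qMin x ≤ ((qDegree s.1 : WithTop ℤ) : WithBot (WithTop ℤ)) :=
  iInf₂_le s hs

/-- An integer bounds the filtration degree of a chain from below iff it bounds the quantum
degrees of all states in the support. [folklore] -/
theorem coe_le_qMin_iff {x : G.degStates 0 → ℚ} {m : ℤ} :
    ((m : WithTop ℤ) : WithBot (WithTop ℤ)) ≤ qMin x ↔ ∀ s, x s ≠ 0 → m ≤ qDegree s.1 := by
  unfold qMin
  rw [le_iInf₂_iff]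
  refine forall_congr' (fun s ↦ forall_congr' (fun _ ↦ ?_))
  rw [WithBot.coe_le_coe, WithTop.coe_le_coe]

/-- **The filtration degree of a nonzero chain is an honest integer**, the least quantum degree
of a state in its (finite, nonempty) support. Rasmussen (2010), §2.2, §3. [cite: Rasmussen2010, §3] -/
theorem exists_qMin_eq_coe {x : G.degStates 0 → ℚ} (hx : x ≠ 0) :
    ∃ s, x s ≠ 0 ∧ qMin x = ((qDegree s.1 : WithTop ℤ) : WithBot (WithTop ℤ)) := by
  classical
  have hne : (Finset.univ.filter fun s : G.degStates 0 ↦ x s ≠ 0).Nonempty := by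
    by_contra h
    rw [Finset.not_nonempty_iff_eq_empty, Finset.filter_eq_empty_iff] at h
    exact hx (funext fun s ↦ not_not.1 (h (Finset.mem_univ s)))
  obtain ⟨s, hs, hmin⟩ := Finset.exists_min_image _ (fun s : G.degStates 0 ↦ qDegree s.1) hne
  rw [Finset.mem_filter] at hs
  refine ⟨s, hs.2, le_antisymm (qMin_le_coe hs.2) ?_⟩
  rw [coe_le_qMin_iff]
  exact fun s' hs' ↦ hmin s' (Finset.mem_filter.2 ⟨Finset.mem_univ _, hs'⟩)

/-- The filtration degree of a sum is at least the smaller filtration degree. [folklore] -/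
theorem min_qMin_le_qMin_add (x y : G.degStates 0 → ℚ) : min (qMin x) (qMin y) ≤ qMin (x + y) := by
  refine le_iInf₂ fun s hs ↦ ?_
  by_cases hx : x s = 0
  · have hy : y s ≠ 0 := by
      intro hy; apply hs; simp [hx, hy]
    exact (min_le_right _ _).trans (qMin_le_coe hy)
  · exact (min_le_left _ _).trans (qMin_le_coe hx)

/-- Scaling by a nonzero scalar keeps the filtration degree. [folklore] -/
theorem qMin_smul {c : ℚ} (hc : c ≠ 0) (x : G.degStates 0 → ℚ) : qMin (c • x) = qMin x :=
  le_antisymm (qMin_le_qMin_of_support fun s hs ↦ by simpa [hc] using hs)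
    (qMin_le_qMin_of_support fun s hs ↦ by
      simp only [Pi.smul_apply, smul_eq_mul, ne_eq, mul_eq_zero, not_or] at hs
      exact hs.2)

/-- The `q mod 4` projectors do not lower the filtration degree (the support shrinks). [folklore] -/
theorem qMin_le_qMin_qProj (ρ : ZMod 4) (x : G.degStates 0 → ℚ) :
    qMin x ≤ qMin (G.qProj ℚ ρ 0 x) :=
  qMin_le_qMin_of_support fun s hs ↦ by
    rw [qProj_apply] at hs
    split_ifs at hs with h
    · exact hs
    · exact (hs rfl).elim

/-- A nonzero chain in the image of `P_ρ` has filtration degree `≡ ρ (mod 4)`. [folklore] -/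
theorem qMin_qProj_modEq {ρ : ZMod 4} {x : G.degStates 0 → ℚ} {m : ℤ} (hx : G.qProj ℚ ρ 0 x ≠ 0)
    (hm : qMin (G.qProj ℚ ρ 0 x) = ((m : WithTop ℤ) : WithBot (WithTop ℤ))) :
    ((m : ℤ) : ZMod 4) = ρ := by
  obtain ⟨s, hs, hq⟩ := exists_qMin_eq_coe hx
  rw [hm] at hq
  have hms : m = qDegree s.1 := by
    have := WithBot.coe_injective hq
    exact_mod_cast this
  rw [qProj_apply] at hs
  split_ifs at hs with h
  · rw [hms]; exact h
  · exact (hs rfl).elim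

/-- **The `X`-operator is filtered of degree `-2`** on chains: a lower bound `m` for the
quantum degrees in the support of `x` gives the lower bound `m - 2` for `X x`.
Rasmussen (2010), §2.1 (multiplication by `X` has filtered degree `-2`). [cite: Rasmussen2010, §2.1] -/
theorem coe_sub_two_le_qMin_leeX (α : G.Arc) {x : G.degStates 0 → ℚ} {m : ℤ}
    (hm : ((m : WithTop ℤ) : WithBot (WithTop ℤ)) ≤ qMin x) :
    (((m - 2 : ℤ) : WithTop ℤ) : WithBot (WithTop ℤ)) ≤ qMin (G.leeX ℚ α 0 x) := by
  rw [coe_le_qMin_iff] at hm ⊢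
  intro s hs
  rw [leeX_apply] at hs
  have h1 := hm _ hs
  have h2 := qDegree_sub_two_le_qDegree_actX (G.actXDeg α 0 s).1 α
  change qDegree (G.actXDeg α 0 (G.actXDeg α 0 s)).1 ≥ _ at h2
  rw [actXDeg_actXDeg] at h2
  omega

/-! ## Filtration degrees of classes -/

/-- A representative of a nonzero class is a nonzero cycle. [folklore] -/
theorem ne_zero_of_mk_eq {z : G.leeCycles} {a : G.LeeH0} (hz : Submodule.Quotient.mk z = a)
    (ha : a ≠ 0) : (z : G.degStates 0 → ℚ) ≠ 0 := by
  rintro h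
  have hz0 : z = 0 := Subtype.ext h
  apply ha
  rw [← hz, hz0]
  rfl

/-- **The filtration degree `s(α)` of a nonzero class is an honest integer, attained by a
representative**: `classDegree α = n` with a representing cycle of filtration degree `≥ n` and
all representing cycles of filtration degree `≤ n` (the set of filtration degrees of the
nonzero representatives is a nonempty set of quantum degrees of degree-zero states, hence
finite). Rasmussen (2010), Def. 3.1 and the preceding discussion of the induced filtration on
homology. [cite: Rasmussen2010, Def. 3.1] -/
theorem exists_classDegree_eq_coe {a : G.LeeH0} (ha : a ≠ 0) :
    ∃ n : ℤ, classDegree a = ((n : WithTop ℤ) : WithBot (WithTop ℤ)) ∧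
      (∃ z : G.leeCycles, Submodule.Quotient.mk z = a ∧
        ((n : WithTop ℤ) : WithBot (WithTop ℤ)) ≤ qMin z.1) ∧
      ∀ z : G.leeCycles, Submodule.Quotient.mk z = a →
        qMin z.1 ≤ ((n : WithTop ℤ) : WithBot (WithTop ℤ)) := by
  classical
  -- the finite set of quantum degrees of degree-zero states, and the attained ones
  set Q : Finset ℤ := Finset.univ.image fun s : G.degStates 0 ↦ qDegree s.1 with hQ
  set T : Finset ℤ := Q.filter fun m ↦ ∃ z : G.leeCycles, Submodule.Quotient.mk z = a ∧
    qMin z.1 = ((m : WithTop ℤ) : WithBot (WithTop ℤ)) with hT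
  have hrep : ∀ z : G.leeCycles, Submodule.Quotient.mk z = a → ∃ m ∈ T,
      qMin z.1 = ((m : WithTop ℤ) : WithBot (WithTop ℤ)) := fun z hz ↦ by
    obtain ⟨s, hs, hq⟩ := exists_qMin_eq_coe (ne_zero_of_mk_eq hz ha)
    refine ⟨qDegree s.1, Finset.mem_filter.2 ⟨?_, z, hz, hq⟩, hq⟩
    exact Finset.mem_image.2 ⟨s, Finset.mem_univ _, rfl⟩
  obtain ⟨z₀, hz₀⟩ := Submodule.Quotient.mk_surjective G.leeBoundaries a
  have hTne : T.Nonempty := by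
    obtain ⟨m, hm, -⟩ := hrep z₀ hz₀
    exact ⟨m, hm⟩
  refine ⟨T.max' hTne, ?_, ?_, ?_⟩
  · apply le_antisymm
    · refine iSup₂_le fun z hz ↦ ?_
      obtain ⟨m, hm, hq⟩ := hrep z hz
      rw [hq]
      exact_mod_cast T.le_max' m hm
    · obtain ⟨z, hz, hq⟩ := (Finset.mem_filter.1 (T.max'_mem hTne)).2
      exact le_iSup₂_of_le z hz hq.ge
  · obtain ⟨z, hz, hq⟩ := (Finset.mem_filter.1 (T.max'_mem hTne)).2
    exact ⟨z, hz, hq.ge⟩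
  · intro z hz
    obtain ⟨m, hm, hq⟩ := hrep z hz
    rw [hq]
    exact_mod_cast T.le_max' m hm

/-- The integer filtration degree of a nonzero class is unique. [folklore] -/
theorem classDegree_coe_injective {a : G.LeeH0} {n n' : ℤ}
    (hn : classDegree a = ((n : WithTop ℤ) : WithBot (WithTop ℤ)))
    (hn' : classDegree a = ((n' : WithTop ℤ) : WithBot (WithTop ℤ))) : n = n' := by
  rw [hn] at hn'
  have := WithBot.coe_injective hn'
  exact_mod_cast this

/-- Scaling a class by a nonzero scalar keeps its filtration degree. [folklore] -/
theorem classDegree_smul {c : ℚ} (hc : c ≠ 0) (a : G.LeeH0) :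
    classDegree (c • a) = classDegree a := by
  have key : ∀ {c : ℚ} (_ : c ≠ 0) (a : G.LeeH0), classDegree a ≤ classDegree (c • a) :=
    fun {c} hc a ↦ iSup₂_le fun z hz ↦ le_iSup₂_of_le (c • z)
      (by change Submodule.Quotient.mk (c • z) = c • a; rw [Submodule.Quotient.mk_smul]; exact congrArg _ hz)
      (by rw [Submodule.coe_smul, qMin_smul hc])
  refine le_antisymm ?_ (key hc a)
  have := key (inv_ne_zero hc) (c • a)
  rwa [smul_smul, inv_mul_cancel₀ hc, one_smul] at this

/-- **Homogeneous classes have filtration degree in their residue class**: a nonzero class in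
the image of the projector `P_ρ` has `s(α) ≡ ρ (mod 4)` (project an optimal representative:
the projection represents the same class and does not lower the filtration degree).
Rasmussen (2010), Lemma 3.5, proof of Cor. 3.7. [cite: Rasmussen2010, Cor. 3.7] -/
theorem classDegree_modEq_of_qProjBar {ρ : ZMod 4} {a : G.LeeH0} (ha : a ≠ 0)
    (hρ : G.qProjBar ρ a = a) {n : ℤ}
    (hn : classDegree a = ((n : WithTop ℤ) : WithBot (WithTop ℤ))) : ((n : ℤ) : ZMod 4) = ρ := by
  obtain ⟨n', hn', ⟨z, hz, hle⟩, hge⟩ := exists_classDegree_eq_coe ha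
  obtain rfl := classDegree_coe_injective hn hn'
  -- the projected representative
  set z' : G.leeCycles := ⟨G.qProj ℚ ρ 0 z,
    map_mem_leeCycles (G.khovanovD_comp_qProj ℚ ρ 0 (0 + 1)) _ z.2⟩ with hz'
  have hz'a : Submodule.Quotient.mk z' = a := by rw [hz', ← qProjBar_mk, hz, hρ]
  have hq : qMin z'.1 = ((n : WithTop ℤ) : WithBot (WithTop ℤ)) :=
    le_antisymm (hge z' hz'a) (hle.trans (qMin_le_qMin_qProj ρ z.1))
  exact qMin_qProj_modEq (ne_zero_of_mk_eq hz'a ha) hq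

/-- **Filtration degree of a sum across the splitting**: for nonzero classes `α₁ ∈ Kh'⁰_{ρ₁}`,
`α₂ ∈ Kh'⁰_{ρ₂}` with `ρ₁ ≠ ρ₂`, `s(α₁ + α₂) = min (s α₁) (s α₂)` (the filtration is the
direct sum of its restrictions to the summands). Rasmussen (2010), Lemma 3.5, Cor. 3.7. [cite: Rasmussen2010, Lemma 3.5] -/
theorem classDegree_add_eq_min {ρ₁ ρ₂ : ZMod 4} (hρ : ρ₁ ≠ ρ₂) {a₁ a₂ : G.LeeH0}
    (ha₁ : a₁ ≠ 0) (ha₂ : a₂ ≠ 0) (h₁ : G.qProjBar ρ₁ a₁ = a₁) (h₂ : G.qProjBar ρ₂ a₂ = a₂)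
    {n₁ n₂ : ℤ} (hn₁ : classDegree a₁ = ((n₁ : WithTop ℤ) : WithBot (WithTop ℤ)))
    (hn₂ : classDegree a₂ = ((n₂ : WithTop ℤ) : WithBot (WithTop ℤ))) :
    classDegree (a₁ + a₂) = (((min n₁ n₂ : ℤ) : WithTop ℤ) : WithBot (WithTop ℤ)) := by
  -- projections of the sum
  have hp₁ : G.qProjBar ρ₁ (a₁ + a₂) = a₁ := by
    rw [map_add, h₁, ← h₂, qProjBar_qProjBar_of_ne hρ, add_zero]
  have hp₂ : G.qProjBar ρ₂ (a₁ + a₂) = a₂ := by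
    rw [map_add, h₂, ← h₁, qProjBar_qProjBar_of_ne (Ne.symm hρ), zero_add]
  have ha : a₁ + a₂ ≠ 0 := fun h ↦ ha₁ (by rw [← hp₁, h, map_zero])
  obtain ⟨n, hn, ⟨z, hz, hle⟩, hge⟩ := exists_classDegree_eq_coe ha
  obtain ⟨m₁, hm₁, ⟨z₁, hz₁, hle₁⟩, hge₁⟩ := exists_classDegree_eq_coe ha₁
  obtain ⟨m₂, hm₂, ⟨z₂, hz₂, hle₂⟩, hge₂⟩ := exists_classDegree_eq_coe ha₂
  obtain rfl := classDegree_coe_injective hn₁ hm₁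
  obtain rfl := classDegree_coe_injective hn₂ hm₂
  rw [hn]
  congr 2
  apply le_antisymm
  · -- `n ≤ n₁` and `n ≤ n₂` by projecting an optimal representative of the sum
    have key : ∀ {ρ : ZMod 4} {b : G.LeeH0} {m : ℤ}, G.qProjBar ρ (a₁ + a₂) = b →
        (∀ w : G.leeCycles, Submodule.Quotient.mk w = b →
          qMin w.1 ≤ ((m : WithTop ℤ) : WithBot (WithTop ℤ))) → n ≤ m := by
      intro ρ b m hb hgeb
      set z' : G.leeCycles := ⟨G.qProj ℚ ρ 0 z,
        map_mem_leeCycles (G.khovanovD_comp_qProj ℚ ρ 0 (0 + 1)) _ z.2⟩ with hz'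
      have hz'b : Submodule.Quotient.mk z' = b := by rw [hz', ← qProjBar_mk, hz, hb]
      have := (hle.trans (qMin_le_qMin_qProj ρ z.1)).trans (hgeb z' hz'b)
      rw [WithBot.coe_le_coe, WithTop.coe_le_coe] at this
      exact this
    exact le_min (key hp₁ hge₁) (key hp₂ hge₂)
  · -- `min n₁ n₂ ≤ n` from the sum of optimal representatives
    have hzz : Submodule.Quotient.mk (z₁ + z₂) = a₁ + a₂ := by
      rw [Submodule.Quotient.mk_add, hz₁, hz₂]
    have hmin : (((min n₁ n₂ : ℤ) : WithTop ℤ) : WithBot (WithTop ℤ)) ≤ min (qMin z₁.1) (qMin z₂.1) :=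
      le_min (le_trans (by exact_mod_cast min_le_left n₁ n₂) hle₁)
        (le_trans (by exact_mod_cast min_le_right n₁ n₂) hle₂)
    have h := hmin.trans ((min_qMin_le_qMin_add z₁.1 z₂.1).trans (hge _ hzz))
    rw [WithBot.coe_le_coe, WithTop.coe_le_coe] at h
    exact h

/-- **`s(X α) ≥ s(α) - 2`** for a nonzero class: the `X`-operator on homology is filtered of
degree `-2`. Rasmussen (2010), §3 (filtered maps induce filtered maps on homology). [cite: Rasmussen2010, §3] -/
theorem classDegree_leeXBar_ge (α : G.Arc) {a : G.LeeH0} (ha : a ≠ 0) {n n' : ℤ}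
    (hn : classDegree a = ((n : WithTop ℤ) : WithBot (WithTop ℤ)))
    (hn' : classDegree (G.leeXBar α a) = ((n' : WithTop ℤ) : WithBot (WithTop ℤ))) :
    n - 2 ≤ n' := by
  have hXa : G.leeXBar α a ≠ 0 := fun h ↦ ha (by rw [← leeXBar_leeXBar α a, h, map_zero])
  obtain ⟨m, hm, ⟨z, hz, hle⟩, -⟩ := exists_classDegree_eq_coe ha
  obtain ⟨m', hm', -, hge'⟩ := exists_classDegree_eq_coe hXa
  obtain rfl := classDegree_coe_injective hn hm
  obtain rfl := classDegree_coe_injective hn' hm'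
  set z' : G.leeCycles := ⟨G.leeX ℚ α 0 z,
    map_mem_leeCycles (G.khovanovD_comp_leeX ℚ α 0 (0 + 1)) _ z.2⟩ with hz'
  have hz'a : Submodule.Quotient.mk z' = G.leeXBar α a := by rw [hz', ← leeXBar_mk, hz]
  have := (coe_sub_two_le_qMin_leeX α hle).trans (hge' z' hz'a)
  rw [WithBot.coe_le_coe, WithTop.coe_le_coe] at this
  exact this

/-! ## `s_max = s_min + 2` -/

/-- A line in `Kh'⁰`: a nonzero vector of a one-dimensional summand spans it. [folklore] -/
theorem exists_generator {p : Submodule ℚ G.LeeH0} (hp : Module.finrank ℚ p = 1) :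
    ∃ v : G.LeeH0, v ∈ p ∧ v ≠ 0 ∧ ∀ w ∈ p, ∃ c : ℚ, c • v = w := by
  obtain ⟨v, hv, hspan⟩ := finrank_eq_one_iff'.1 hp
  refine ⟨v, v.2, fun h ↦ hv (Subtype.ext h), fun w hw ↦ ?_⟩
  obtain ⟨c, hc⟩ := hspan ⟨w, hw⟩
  exact ⟨c, by simpa using congrArg Subtype.val hc⟩

/-- **Rasmussen's Proposition 3.3 from the dimension of `Kh'⁰` alone.** For every Gauss diagram
whose degree-zero Lee homology is two-dimensional over `ℚ`, `s_max = s_min + 2`. (For knot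
diagrams the hypothesis is Lee's theorem, `finrank_leeHomologyZero_eq_two`; the proof — via
the `q mod 4` splitting and the base-point `X`-action instead of Rasmussen's connected-sum
sequence — is described in the module docstring.) Rasmussen (2010), Prop. 3.3. [cite: Rasmussen2010, Prop. 3.3] -/
theorem leeSMax_eq_leeSMin_add_two_of_finrank_eq_two {G : GaussDiagram}
    (h2 : Module.finrank ℚ G.LeeHomologyZero = 2) : G.leeSMax = G.leeSMin + 2 := by
  have h2' : Module.finrank ℚ G.LeeH0 = 2 := h2
  -- a base point: an arc of `G` (there is always one, `arcCount = max (2 n) 1`; this is the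
  -- element `GaussDiagram.arcZero` of `LeeRasmussenLabProofs`, not imported here)
  let α : G.Arc := ⟨0, by unfold arcCount; omega⟩
  obtain ⟨ρ₀, hρ₀, hρ₂, hP₁, hP₃⟩ := exists_finrank_range_qProjBar α h2'
  -- generators of the two lines
  obtain ⟨v₁, hv₁, hv₁0, hspan₁⟩ := exists_generator hρ₀
  obtain ⟨v₂, hv₂, hv₂0, hspan₂⟩ := exists_generator hρ₂
  have hfix₁ : G.qProjBar ρ₀ v₁ = v₁ := by
    obtain ⟨w, rfl⟩ := hv₁; exact qProjBar_qProjBar ρ₀ w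
  have hfix₂ : G.qProjBar (ρ₀ + 2) v₂ = v₂ := by
    obtain ⟨w, rfl⟩ := hv₂; exact qProjBar_qProjBar (ρ₀ + 2) w
  obtain ⟨n₁, hn₁, -, -⟩ := exists_classDegree_eq_coe hv₁0
  obtain ⟨n₂, hn₂, -, -⟩ := exists_classDegree_eq_coe hv₂0
  -- residues mod 4
  have hr₁ := classDegree_modEq_of_qProjBar hv₁0 hfix₁ hn₁
  have hr₂ := classDegree_modEq_of_qProjBar hv₂0 hfix₂ hn₂
  have hdvd : (4 : ℤ) ∣ (n₂ - (n₁ + 2)) := by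
    have h := (ZMod.intCast_zmod_eq_zero_iff_dvd (n₂ - (n₁ + 2)) 4).1 (by
      push_cast
      rw [hr₁, hr₂]
      ring)
    exact_mod_cast h
  -- `|n₁ - n₂| ≤ 2` from the `X`-operator
  have hX₁ : G.leeXBar α v₁ ∈ LinearMap.range (G.qProjBar (ρ₀ + 2)) := leeXBar_mem_range α ρ₀ hv₁
  have hX₂ : G.leeXBar α v₂ ∈ LinearMap.range (G.qProjBar ρ₀) := by
    have := leeXBar_mem_range α (ρ₀ + 2) hv₂
    rwa [zmod_four_add_two_add_two] at this
  have hX₁0 : G.leeXBar α v₁ ≠ 0 := fun h ↦ hv₁0 (by rw [← leeXBar_leeXBar α v₁, h, map_zero])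
  have hX₂0 : G.leeXBar α v₂ ≠ 0 := fun h ↦ hv₂0 (by rw [← leeXBar_leeXBar α v₂, h, map_zero])
  have hdX₁ : classDegree (G.leeXBar α v₁) = ((n₂ : WithTop ℤ) : WithBot (WithTop ℤ)) := by
    obtain ⟨c, hc⟩ := hspan₂ _ hX₁
    have hc0 : c ≠ 0 := by rintro rfl; exact hX₁0 (by rw [← hc, zero_smul])
    rw [← hc, classDegree_smul hc0, hn₂]
  have hdX₂ : classDegree (G.leeXBar α v₂) = ((n₁ : WithTop ℤ) : WithBot (WithTop ℤ)) := by
    obtain ⟨c, hc⟩ := hspan₁ _ hX₂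
    have hc0 : c ≠ 0 := by rintro rfl; exact hX₂0 (by rw [← hc, zero_smul])
    rw [← hc, classDegree_smul hc0, hn₁]
  have h12 := classDegree_leeXBar_ge α hv₁0 hn₁ hdX₁
  have h21 := classDegree_leeXBar_ge α hv₂0 hn₂ hdX₂
  have hgap : max n₁ n₂ = min n₁ n₂ + 2 := by
    omega
  have hne : (ρ₀ : ZMod 4) ≠ ρ₀ + 2 := by
    intro h
    have h' : (2 : ZMod 4) = 0 := by
      have := congrArg (fun x ↦ x - ρ₀) h
      simpa using this.symm
    exact absurd h' (by decide)
  -- the `s`-value of every nonzero class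
  have hall : ∀ a : G.LeeH0, a ≠ 0 →
      (((min n₁ n₂ : ℤ) : WithTop ℤ) : WithBot (WithTop ℤ)) ≤ classDegree a ∧
        classDegree a ≤ (((max n₁ n₂ : ℤ) : WithTop ℤ) : WithBot (WithTop ℤ)) := by
    intro a ha
    have hdec : a = G.qProjBar ρ₀ a + G.qProjBar (ρ₀ + 2) a := by
      have hs := sum_qProjBar a
      rw [Finset.sum_eq_add ρ₀ (ρ₀ + 2) hne ?_ (fun h ↦ (h (Finset.mem_univ _)).elim)
        (fun h ↦ (h (Finset.mem_univ _)).elim)] at hs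
      · exact hs.symm
      · rintro ρ - ⟨h₁, h₂⟩
        rcases zmod_four_eq_add_cases ρ₀ ρ with rfl | rfl | rfl | rfl
        · exact (h₁ rfl).elim
        · rw [hP₁, LinearMap.zero_apply]
        · exact (h₂ rfl).elim
        · rw [hP₃, LinearMap.zero_apply]
    obtain ⟨c₁, hc₁⟩ := hspan₁ _ (LinearMap.mem_range_self _ a : G.qProjBar ρ₀ a ∈ _)
    obtain ⟨c₂, hc₂⟩ := hspan₂ _ (LinearMap.mem_range_self _ a : G.qProjBar (ρ₀ + 2) a ∈ _)
    have hbounds : ∀ {m : ℤ}, (m = n₁ ∨ m = n₂ ∨ m = min n₁ n₂) →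
        (((min n₁ n₂ : ℤ) : WithTop ℤ) : WithBot (WithTop ℤ)) ≤ ((m : WithTop ℤ) : WithBot (WithTop ℤ)) ∧
        ((m : WithTop ℤ) : WithBot (WithTop ℤ)) ≤ (((max n₁ n₂ : ℤ) : WithTop ℤ) : WithBot (WithTop ℤ)) := by
      rintro m (rfl | rfl | rfl) <;>
        exact ⟨by exact_mod_cast (by omega), by exact_mod_cast (by omega)⟩
    by_cases h₁ : c₁ = 0
    · -- `a` lies in the second line
      have ha₂ : a = c₂ • v₂ := by rw [hdec, ← hc₁, ← hc₂, h₁, zero_smul, zero_add]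
      have hc₂0 : c₂ ≠ 0 := by rintro rfl; exact ha (by rw [ha₂, zero_smul])
      rw [ha₂, classDegree_smul hc₂0, hn₂]
      exact hbounds (Or.inr (Or.inl rfl))
    by_cases h₂ : c₂ = 0
    · have ha₁ : a = c₁ • v₁ := by rw [hdec, ← hc₁, ← hc₂, h₂, zero_smul, add_zero]
      rw [ha₁, classDegree_smul h₁, hn₁]
      exact hbounds (Or.inl rfl)
    · -- both components nonzero
      have hb₁ : c₁ • v₁ ≠ 0 := smul_ne_zero h₁ hv₁0
      have hb₂ : c₂ • v₂ ≠ 0 := smul_ne_zero h₂ hv₂0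
      have hf₁ : G.qProjBar ρ₀ (c₁ • v₁) = c₁ • v₁ := by rw [map_smul, hfix₁]
      have hf₂ : G.qProjBar (ρ₀ + 2) (c₂ • v₂) = c₂ • v₂ := by rw [map_smul, hfix₂]
      have hd₁ : classDegree (c₁ • v₁) = ((n₁ : WithTop ℤ) : WithBot (WithTop ℤ)) := by
        rw [classDegree_smul h₁, hn₁]
      have hd₂ : classDegree (c₂ • v₂) = ((n₂ : WithTop ℤ) : WithBot (WithTop ℤ)) := by
        rw [classDegree_smul h₂, hn₂]
      have := classDegree_add_eq_min hne hb₁ hb₂ hf₁ hf₂ hd₁ hd₂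
      rw [hc₁, hc₂, ← hdec] at this
      rw [this]
      exact hbounds (Or.inr (Or.inr rfl))
  -- evaluate `s_max` and `s_min`
  have hmax : G.leeSMax = (((max n₁ n₂ : ℤ) : WithTop ℤ) : WithBot (WithTop ℤ)) := by
    apply le_antisymm
    · exact iSup₂_le fun a ha ↦ (hall a ha).2
    · have h1 : ((n₁ : WithTop ℤ) : WithBot (WithTop ℤ)) ≤ G.leeSMax :=
        le_iSup₂_of_le v₁ hv₁0 hn₁.ge
      have h2 : ((n₂ : WithTop ℤ) : WithBot (WithTop ℤ)) ≤ G.leeSMax :=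
        le_iSup₂_of_le v₂ hv₂0 hn₂.ge
      rw [WithTop.coe_max, WithBot.coe_max]
      exact max_le h1 h2
  have hmin : G.leeSMin = (((min n₁ n₂ : ℤ) : WithTop ℤ) : WithBot (WithTop ℤ)) := by
    apply le_antisymm
    · have h1 : G.leeSMin ≤ ((n₁ : WithTop ℤ) : WithBot (WithTop ℤ)) :=
        iInf₂_le_of_le v₁ hv₁0 hn₁.le
      have h2 : G.leeSMin ≤ ((n₂ : WithTop ℤ) : WithBot (WithTop ℤ)) :=
        iInf₂_le_of_le v₂ hv₂0 hn₂.le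
      rw [WithTop.coe_min, WithBot.coe_min]
      exact le_min h1 h2
    · exact le_iInf₂ fun a ha ↦ (hall a ha).1
  rw [hmax, hmin, hgap]
  rfl

/-- **Rasmussen's Proposition 3.3 reduced to Lee's theorem.** The named fact
`leeSMax_eq_leeSMin_add_two` (`s_max = s_min + 2` for knot diagrams; Rasmussen (2010),
Prop. 3.3) follows from the named fact `finrank_leeHomologyZero_eq_two` (Lee (2005),
Thm. 4.2: `dim Kh'⁰ = 2` for knot diagrams). [cite: Rasmussen2010, Prop. 3.3] -/
theorem leeSMax_eq_leeSMin_add_two_of_finrank (hfin : finrank_leeHomologyZero_eq_two) :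
    leeSMax_eq_leeSMin_add_two :=
  fun hG ↦ leeSMax_eq_leeSMin_add_two_of_finrank_eq_two (hfin hG)

end GaussDiagram

end Literature.Topology.FourManifolds
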